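import Summits.MatrixMultiplication.MatrixMultiplication.Statement
import HarnessLib

/-!
# MatrixMultiplication — summit statement (D-0017)

Single-conjunct summit: the statement `MatrixMultiplication` is defined in
`Summits/MatrixMultiplication/MatrixMultiplication/Statement.lean` (restored by the operator, p3932); this file re-exports it
by import.
-/
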